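import Summits.QuantumAdvantage.AdviceFreeQNC0.WalkHardLogOverLogLog
import Summits.QuantumAdvantage.AdviceFreeQNC0.WalkTransport
import HarnessLib

/-!
# Cell qa-qnc0 (rung F-Q1, route RingFrame, crux α): "Theorem V" in ring form — every tuple of
# `𝔽₂`-polynomials of degree `≤ c·log₂ n / log₂ log₂ n` solves the ring relation on at most `θ·2ⁿ` inputs

The `RingHLF.Rel` form of planner qa-qnc0-p1's T7 (ROUND-9 §6b, ask P10, Sketch10
`ringHard_logOverLogLogDeg`): transport of `walkHard_logOverLogLog` (`WalkHardLogOverLogLog.lean`)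
through the walk coordinates exactly as `ringHard_sqrtLogDeg` (`ProductHardSqrtLog.lean`, p444026)
transports Theorem U — one UNCONDITIONAL rung above Theorem U on the crux α = `RingHard 2`
(stmt-QuantumAdvantage-19119):

* `ringHard_logOverLogLogDeg`: there are absolute `θ < 1`, `c > 0`, `n₀` such that for `n ≥ n₀` and
  every `d` with `d·(log₂ d + 1) ≤ c·log₂ n`, every tuple `P` of `𝔽₂`-polynomials of degree `≤ d`
  satisfies `RingHLF.Rel x (P x)` for at most `θ·2ⁿ` patterns `x`.

(`RingHard 2` asks the same at degree `(log₂ n)^C` for every `C`; the banked aside `RingHardLogDeg`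
at degree `≍ ½ log₂ n`.)  WHAT THIS IS NOT: nothing at polylog degree; constants astronomically small;
no separation claim.
-/

noncomputable section

namespace Summit.QuantumAdvantage.AdviceFreeQNC0

open Finset Literature.Computability.QuantumComplexity Literature.Computability.QuantumComplexity.RingHLF
open Literature.Computability.MetaComplexity Literature.Computability.MetaComplexity.Smolensky

/-- **Ring-game hardness up to degree `c·log₂ n / log₂ log₂ n`** (the `RingHLF.Rel` form of
Theorem V). -/
theorem ringHard_logOverLogLogDeg :
    ∃ θ : ℝ, θ < 1 ∧ ∃ c : ℝ, 0 < c ∧ ∃ n₀ : ℕ, ∀ n ≥ n₀, ∀ d : ℕ,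
      (d : ℝ) * (Nat.log 2 d + 1) ≤ c * Nat.log 2 n →
      ∀ P : Fin n → CubeFn (ZMod 2) n, (∀ i, P i ∈ lowDeg (ZMod 2) n d) →
        ((univ.filter fun x : Fin n → Bool => Rel x (fun i => decide (P i x = 1))).card : ℝ) ≤
          θ * (2 : ℝ) ^ n := by
  classical
  obtain ⟨θ', hθ', c, hc, n₀, hW⟩ := walkHard_logOverLogLog
  -- `n₁`: from here on the budget `c·log₂ n` is at least `1` (room for degree-`0` strategies)
  obtain ⟨n₁, hn₁⟩ : ∃ n₁ : ℕ, ∀ n ≥ n₁, (1 : ℝ) ≤ c * Nat.log 2 n := by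
    refine ⟨2 ^ Nat.ceil (1 / c), fun n hn => ?_⟩
    have hlog : Nat.ceil (1 / c) ≤ Nat.log 2 n := Nat.le_log_of_pow_le (by norm_num) hn
    have h1 : 1 / c ≤ (Nat.log 2 n : ℝ) := le_trans (Nat.le_ceil _) (by exact_mod_cast hlog)
    calc (1 : ℝ) = c * (1 / c) := by field_simp
      _ ≤ c * Nat.log 2 n := mul_le_mul_of_nonneg_left h1 hc.le
  refine ⟨(1 + θ') / 2, by linarith, c / 2, by positivity, max (max (n₀ + 1) (n₁ + 1)) 5,
    fun N hN d hd P hP => ?_⟩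
  obtain ⟨n, rfl⟩ : ∃ n, N = n + 1 := ⟨N - 1, by omega⟩
  have hn₀n : n₀ ≤ n := by have := le_max_left (max (n₀ + 1) (n₁ + 1)) 5; omega
  have hn₁n : n₁ ≤ n := by have := le_max_left (max (n₀ + 1) (n₁ + 1)) 5; omega
  have hn4 : 4 ≤ n := by have := le_max_right (max (n₀ + 1) (n₁ + 1)) 5; omega
  -- the degree of the transported strategy: `D = max d 1`
  set D := max d 1 with hDdef
  have hone : 1 ≤ D := le_max_right _ _
  have hlog : Nat.log 2 (n + 1) ≤ 2 * Nat.log 2 n := by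
    have h1 : Nat.log 2 (n + 1) ≤ Nat.log 2 n + 1 := by
      have h : n + 1 ≤ 2 ^ (Nat.log 2 n + 1) := Nat.lt_pow_succ_log_self (by norm_num) n
      calc Nat.log 2 (n + 1) ≤ Nat.log 2 (2 ^ (Nat.log 2 n + 1)) := Nat.log_mono_right h
        _ = Nat.log 2 n + 1 := Nat.log_pow (by norm_num) _
    have h2 : 2 ≤ Nat.log 2 n := Nat.le_log_of_pow_le (by norm_num) (by omega)
    omega
  have hD : (D : ℝ) * (Nat.log 2 D + 1) ≤ c * Nat.log 2 n := by
    rcases le_total d 1 with h | h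
    · rw [hDdef, max_eq_right h]
      simp only [Nat.cast_one, Nat.log_one_right, Nat.cast_zero, zero_add, one_mul]
      exact hn₁ n hn₁n
    · rw [hDdef, max_eq_left h]
      have hreal : (Nat.log 2 (n + 1) : ℝ) ≤ 2 * (Nat.log 2 n : ℝ) := by exact_mod_cast hlog
      calc (d : ℝ) * (Nat.log 2 d + 1) ≤ c / 2 * Nat.log 2 (n + 1) := hd
        _ ≤ c / 2 * (2 * (Nat.log 2 n : ℝ)) := mul_le_mul_of_nonneg_left hreal (by positivity)
        _ = c * Nat.log 2 n := by ring
  -- the transported walk strategy and its degree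
  set z : (Fin (n + 1) → Bool) → (Fin (n + 1) → Bool) := fun x i => decide (P i x = 1) with hz
  set y : Fin (n + 1) → (Fin n → Bool) → Bool :=
    fun g u => xor (z (xOfU u) g) (tGuess (xOfU u) g) with hy
  have hdeg : ∀ g, HasDeg (y g) D := by
    intro g
    have hPg : P g ∈ lowDeg (ZMod 2) (n + 1) D := lowDeg_mono (le_max_left d 1) (hP g)
    exact hasDeg_transport hone (P g) hPg g
  have hwin := hW n hn₀n D hD (n + 2) y hdeg
  -- split the solved patterns by the parity of the number of zeros
  set Sx := univ.filter fun x : Fin (n + 1) → Bool => Rel x (z x) with hSx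
  set OddZ : (Fin (n + 1) → Bool) → Prop := fun x =>
    (univ.filter fun j : Fin (n + 1) => x j = false).card % 2 = 1 with hOddZ
  have hsplit : Sx.card = (Sx.filter OddZ).card + (Sx.filter fun x => ¬ OddZ x).card :=
    (Finset.card_filter_add_card_filter_not _).symm
  have heven : (Sx.filter fun x => ¬ OddZ x).card ≤ 2 ^ n := by
    refine le_trans (Finset.card_le_card ?_) card_even_class_le
    intro x hx
    rw [mem_filter] at hx ⊢
    exact ⟨mem_univ _, hx.2⟩
  have hodd : (Sx.filter OddZ).card ≤
      (univ.filter fun u : Fin n → Bool => ringWinU (n + 2) y u = true).card := by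
    refine Finset.card_le_card_of_injOn uVec ?_ ?_
    · intro x hx
      rw [Finset.mem_coe, mem_filter, hSx, mem_filter] at hx
      rw [Finset.mem_coe, mem_filter]
      exact ⟨mem_univ _, (rel_iff_ringWinU (by omega) x hx.2 z).1 hx.1.2⟩
    · intro x₁ hx₁ x₂ hx₂ h
      rw [Finset.mem_coe, mem_filter] at hx₁ hx₂
      rw [← xOfU_uVec (by omega) x₁ hx₁.2, ← xOfU_uVec (by omega) x₂ hx₂.2, h]
  -- arithmetic
  have hS : (Sx.card : ℝ) ≤ 2 ^ n + θ' * 2 ^ n := by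
    have h1 : (Sx.card : ℝ) ≤ ((Sx.filter fun x => ¬ OddZ x).card : ℝ) +
        ((Sx.filter OddZ).card : ℝ) := by
      rw [hsplit]; push_cast; linarith
    have h2 : ((Sx.filter fun x => ¬ OddZ x).card : ℝ) ≤ 2 ^ n := by exact_mod_cast heven
    have h3 : ((Sx.filter OddZ).card : ℝ) ≤ θ' * 2 ^ n := le_trans (by exact_mod_cast hodd) hwin
    linarith
  have hpow : (2 : ℝ) ^ (n + 1) = 2 * 2 ^ n := by ring
  calc (Sx.card : ℝ) ≤ 2 ^ n + θ' * 2 ^ n := hS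
    _ = (1 + θ') / 2 * (2 : ℝ) ^ (n + 1) := by rw [hpow]; ring

end Summit.QuantumAdvantage.AdviceFreeQNC0

end
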